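import Mathlib
import Summits.ResolutionOfSingularities.ResolutionOfSingularities.Theorems.RadicialJungCleanModelsLens5TFrameCompositionInf
import HarnessLib

/-!
# Route `RadicialJung`, crux `CleanModels` (stmt-15917): T‴ port part 10/10 — base change along a finite intermediate field of constants, THEOREM T‴ `cleanLU3DefectPRankTwoSepConst_of_cossartPiltant2019` (relative to T″) and the uptake glue `cleanLUConcl_of_sepConst` (source `Lens5_TPrimeConst.lean` §2–§4)

PORT (line lead `res-B-lead-1` g8, for Sketch rev 33) of res-B-lens-5's crux workfiles `Cruxes/DescentPerfectToAll/Lens5_TPrimeInfCurrency.lean` rev 4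
(crux 75ffdaa75b27; author res-B-lens-5 g14), the T″ theorem module prepared by the author from `Lens5_TPrimeInf.lean` rev 3 (HOME
`B/res-B-lens-5/g14/PORTALPHA_TPrimeInf_theorem_module.lean`, sha16 48c5cb0bf6ec7b34, certified by the author's one-file simulation) and
`Cruxes/DescentPerfectToAll/Lens5_TPrimeConst.lean` rev 1 (4e5e6a0028c2): THEOREMS T′_∞ / T″ / T‴ — the slice {`[Γ:pΓ] = p²`, `K/k′` separably
generated and `κ_v/k′` SEPARABLE for some finite intermediate field of constants `k ⊆ k′ ⊆ K`} of the research stub `stub_cleanLU3DefectNonDiscrete`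
(grounds of ARBITRARY, possibly infinite, `p`-rank), modulo F-02 `CossartPiltant2019` and F-32 (`hEmb`) only.  Continues the T⁗-family port
(`…Lens5TFrame{Currency,…,PDegreeC}`): same namespace `Summit.ResolutionOfSingularities.ResolutionOfSingularities.Theorems.RadicialJungCleanModels.Lens5TFrame`,
declarations VERBATIM; the authors' copies of §B/§B′ (defs) and §C/§D (RG/IR lemmas) are NOT repeated — they are the landed `…Lens5TFrameCurrency` /
`…Lens5TFrameRG` / `…Lens5TFrameIR` declarations of the same names and statements; §C′/§B‴ (unused bridges) and the T′_fin/T′₁/«T″ ⊇ T» corollaries are not ported.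
OURS · counted 0 · nothing here proves resolution in characteristic `p`.


-/

set_option linter.dupNamespace false -- mandated namespace of this single-conjunct summit

section

open IsLocalRing
open Literature.AlgebraicGeometry.Resolution
open Summit.ResolutionOfSingularities.ResolutionOfSingularities.Theorems.RadicialJung.CleanModels
open Summit.ResolutionOfSingularities.ResolutionOfSingularities.Theorems.RadicialJung.CleanModels.Lens5
open Summit.ResolutionOfSingularities.ResolutionOfSingularities.Theorems.RadicialJung.CleanModels.Lens5.PRankTwoCurrency

namespace Summit.ResolutionOfSingularities.ResolutionOfSingularities.Theorems.RadicialJungCleanModels.Lens5TFrame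

/-! ## §2 Base change along a finite intermediate field `k ⊆ k' ⊆ K` (folklore lemmas) -/

section BaseField

variable {k : Type} [Field k] {K : Type} [Field K] [Algebra k K]

/-- A finite (indeed any algebraic) intermediate field `k'` of `K/k` lies in every valuation ring of `K` containing `k`:
its elements are integral over `k ⊆ O`, and `O` is integrally closed in `K`. [folklore] -/
theorem algebraMap_mem_of_isAlgebraic (O : ValuationSubring K) (hk : ∀ c : k, algebraMap k K c ∈ O)
    (k' : IntermediateField k K) [Algebra.IsAlgebraic k k'] (c : k') : algebraMap k' K c ∈ O := by
  letI : Algebra k O := algebraOfMem k O hk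
  haveI := isScalarTower_algebraOfMem k O hk
  have hint : IsIntegral k (algebraMap k' K c) :=
    (Algebra.IsIntegral.isIntegral (R := k) c).map (IsScalarTower.toAlgHom k k' K)
  have hintO : IsIntegral O (algebraMap k' K c) := hint.tower_top
  have hv : O.valuation.Integers O :=
    ⟨Subtype.val_injective, fun x => O.valuation_le_one x,
      fun r hr => ⟨⟨r, O.mem_of_valuation_le_one r hr⟩, rfl⟩⟩
  exact (O.valuation_le_one_iff _).mp ((hv.isIntegral_iff_v_le_one).mp hintO)

/-- `Frac` is inherited by over-rings inside `K` (across a change of ground field). [folklore] -/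
theorem isFractionRing_of_toSubring_le {k' : Type} [Field k'] [Algebra k' K] {A : Subalgebra k K} {A₁ : Subalgebra k' K}
    (hle : A.toSubring ≤ A₁.toSubring) (hA : IsFractionRing A K) : IsFractionRing A₁ K := by
  refine IsFractionRing.of_field A₁ K fun z => ?_
  obtain ⟨a, b, -, rfl⟩ := IsFractionRing.div_surjective (A := A) z
  exact ⟨⟨a, hle a.2⟩, ⟨b, hle b.2⟩, rfl⟩

/-- `trdeg_{k'} K = trdeg_k K` for an algebraic intermediate field `k'`. [folklore] -/
theorem trdeg_eq_of_intermediateField (k' : IntermediateField k K) [Algebra.IsAlgebraic k k'] :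
    Algebra.trdeg k' K = Algebra.trdeg k K := by
  haveI : FaithfulSMul k k' := (faithfulSMul_iff_algebraMap_injective k k').mpr (algebraMap k k').injective
  haveI : FaithfulSMul k' K := (faithfulSMul_iff_algebraMap_injective k' K).mpr (algebraMap k' K).injective
  rw [← trdeg_add_eq k k' (A := K), trdeg_eq_zero (R := k) (A := k'), zero_add]

/-- An affine `k'`-model of `K = Frac A` (`A` an affine `k`-model of dimension `3`) has dimension `3`, `k'/k` algebraic. [folklore] -/
theorem ringKrullDim_eq_three_of_intermediateField (k' : IntermediateField k K) [Algebra.IsAlgebraic k k']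
    (A : Subalgebra k K) (hAfg : A.FG) [IsFractionRing A K] (hdimA : ringKrullDim A = 3)
    (A₂ : Subalgebra k' K) (hA₂fg : A₂.FG) (hfr₂ : IsFractionRing A₂ K) : ringKrullDim A₂ = 3 := by
  haveI : Algebra.FiniteType k A := A.fg_iff_finiteType.mp hAfg
  haveI : Algebra.FiniteType k' A₂ := A₂.fg_iff_finiteType.mp hA₂fg
  obtain ⟨n, hnA, htrA⟩ := Literature.RingTheory.KrullDimension.exists_ringKrullDim_eq_and_trdeg_eq k A
  obtain ⟨m, hmA₂, htrA₂⟩ := Literature.RingTheory.KrullDimension.exists_ringKrullDim_eq_and_trdeg_eq k' A₂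
  haveI : FaithfulSMul k A := (faithfulSMul_iff_algebraMap_injective k A).mpr (algebraMap k A).injective
  haveI : FaithfulSMul A K := (faithfulSMul_iff_algebraMap_injective A K).mpr (IsFractionRing.injective A K)
  haveI : Algebra.IsAlgebraic A K := IsLocalization.isAlgebraic K (nonZeroDivisors A)
  haveI : FaithfulSMul k' A₂ := (faithfulSMul_iff_algebraMap_injective k' A₂).mpr (algebraMap k' A₂).injective
  haveI : FaithfulSMul A₂ K := (faithfulSMul_iff_algebraMap_injective A₂ K).mpr (IsFractionRing.injective A₂ K)
  haveI : Algebra.IsAlgebraic A₂ K := IsLocalization.isAlgebraic K (nonZeroDivisors A₂)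
  have htrK : Algebra.trdeg k K = (n : Cardinal) := by
    rw [← trdeg_add_eq k A (A := K), trdeg_eq_zero (R := A) (A := K), add_zero, htrA]
  have htrK' : Algebra.trdeg k' K = (m : Cardinal) := by
    rw [← trdeg_add_eq k' A₂ (A := K), trdeg_eq_zero (R := A₂) (A := K), add_zero, htrA₂]
  have hmn : (m : Cardinal) = n := by rw [← htrK', ← htrK, trdeg_eq_of_intermediateField k']
  have hmn' : m = n := by exact_mod_cast hmn
  rw [hmA₂, hmn']
  rw [hnA] at hdimA
  exact hdimA

/-- The transcendence defect of `v` over a trivially valued ground field is insensitive to an algebraic enlargement `k ⊆ k' ⊆ O`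
of the ground field (`trdeg` of `K` and of `κ_v` are, `ratRank` does not see the ground field). [folklore] -/
theorem transcendenceDefect_eq_of_intermediateField (k' : IntermediateField k K) [Algebra.IsAlgebraic k k']
    (O : ValuationSubring K) (hk : ∀ c : k, algebraMap k K c ∈ O) (hk' : ∀ c : k', algebraMap k' K c ∈ O) :
    transcendenceDefect k' O hk' = transcendenceDefect k O hk := by
  have h1 : Algebra.trdeg k' K = Algebra.trdeg k K := trdeg_eq_of_intermediateField k'
  have h2 : residueTrdeg k' O hk' = residueTrdeg k O hk := by
    letI i1 : Algebra k O := algebraOfMem k O hk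
    letI i2 : Algebra k' O := algebraOfMem k' O hk'
    haveI : IsScalarTower k k' (ResidueField O) := IsScalarTower.of_algebraMap_eq fun c => rfl
    haveI : FaithfulSMul k k' := (faithfulSMul_iff_algebraMap_injective k k').mpr (algebraMap k k').injective
    haveI : FaithfulSMul k' (ResidueField O) :=
      (faithfulSMul_iff_algebraMap_injective k' (ResidueField O)).mpr (algebraMap k' (ResidueField O)).injective
    show Algebra.trdeg k' (ResidueField O) = Algebra.trdeg k (ResidueField O)
    rw [← trdeg_add_eq k k' (A := ResidueField O), trdeg_eq_zero (R := k) (A := k'), zero_add]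
  unfold transcendenceDefect
  rw [h1, h2]

/-- Restricting scalars along a finite `k'/k` preserves finite generation. [folklore] -/
theorem fg_restrictScalars_of_finiteDimensional (k' : IntermediateField k K) [FiniteDimensional k k']
    (A' : Subalgebra k' K) (h : A'.FG) : (A'.restrictScalars k).FG := by
  haveI : Algebra.FiniteType k' A' := A'.fg_iff_finiteType.mp h
  haveI : Algebra.FiniteType k A' := Algebra.FiniteType.trans (S := k') inferInstance inferInstance
  exact (A'.restrictScalars k).fg_iff_finiteType.mpr (show Algebra.FiniteType k A' from inferInstance)

end BaseField

/-! ## §3 THEOREM T‴ (relative form): T″ over every ground field + F-02 in LU³ form ⟹ the field-of-constants slice -/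

/-- **THEOREM T‴ (kernel-checked, relative to T″)**: if T″'s slice holds (over every ground field of characteristic `p` — it does, by
`…TPrimeInf.cleanLU3DefectPRankTwoSepRes_of_cossartPiltant2019`, modulo F-02 and F-32) and F-02 holds in LU³ form over every field
(✓ `CossartPiltant2019.lu3`), then `stub_cleanLU3DefectNonDiscrete` holds on {`[Γ : pΓ] = p²`} × {`K/k'` separably generated and
`κ_v/k'` separable for SOME finite intermediate field `k'`}.  OURS · CANDIDATE · counted 0; resolution in char p NOT proved. [folklore] -/
theorem cleanLU3DefectPRankTwoSepConst_of_sepRes (p : ℕ)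
    (hLU3 : ∀ (k : Type) [Field k], LocalUniformization3 k) (hT : CleanLU3DefectPRankTwoSepResAt p) :
    CleanLU3DefectPRankTwoSepConstAt p := by
  intro k _ _ K _ _ O A hAO hAfg hFrac hdimA hreg hdim3 hzd g₀ hg₀ hdefect htd hnd hP2 k' hfin hsep' _ hcomp' hks'
  classical
  haveI := hFrac
  haveI := hfin
  haveI : CharP K p := charP_of_injective_algebraMap (algebraMap k K).injective p
  haveI : CharP k' p := charP_of_injective_algebraMap (algebraMap k k').injective p
  haveI : Algebra.IsAlgebraic k k' := Algebra.IsAlgebraic.of_finite k k'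
  have hk : ∀ c : k, algebraMap k K c ∈ O := fun c => hAO (A.algebraMap_mem c)
  have hk'O : ∀ c : k', algebraMap k' K c ∈ O := fun c => algebraMap_mem_of_isAlgebraic O hk k' c
  -- the affine `k'`-model `A₁ := k'[A]` inside `O`
  obtain ⟨s, hs⟩ := hAfg
  let A₁ : Subalgebra k' K := Algebra.adjoin k' (s : Set K)
  have hAA₁ : A.toSubring ≤ A₁.toSubring := by
    intro x hx
    have hx' : x ∈ Algebra.adjoin k (s : Set K) := hs ▸ hx
    have hle : Algebra.adjoin k (s : Set K) ≤ A₁.restrictScalars k :=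
      Algebra.adjoin_le fun y hy => (Subalgebra.mem_restrictScalars k).mpr (Algebra.subset_adjoin hy)
    exact (Subalgebra.mem_restrictScalars k).mp (hle hx')
  have hA₁fg : A₁.FG := ⟨s, rfl⟩
  have hA₁O : A₁.toSubring ≤ O.toSubring := by
    let OA : Subalgebra k' K := { O.toSubring with algebraMap_mem' := fun c => hk'O c }
    have hle : A₁ ≤ OA := Algebra.adjoin_le fun x hx => hAO (show x ∈ A from hs ▸ Algebra.subset_adjoin hx)
    exact fun x hx => hle hx
  have hfr₁ : IsFractionRing A₁ K := isFractionRing_of_toSubring_le hAA₁ hFrac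
  have hdimAeq : ringKrullDim A = 3 := TwistModel.ringKrullDim_eq_three_of_locAtCentre O A hAO hdimA hdim3
  have hdimA₁ : ringKrullDim A₁ = 3 :=
    ringKrullDim_eq_three_of_intermediateField k' A ⟨s, hs⟩ hdimAeq A₁ hA₁fg hfr₁
  -- F-02 in LU³ form over `k'`
  obtain ⟨A₂, hA₂O, hA₁A₂, hA₂fg, hreg₂'⟩ := hLU3 k' K O A₁ hA₁O hA₁fg hfr₁ hdimA₁.le
  have hA₁A₂' : A₁.toSubring ≤ A₂.toSubring := fun x hx => hA₁A₂ hx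
  have hfr₂ : IsFractionRing A₂ K := isFractionRing_of_toSubring_le hA₁A₂' hfr₁
  have hdimA₂ : ringKrullDim A₂ = 3 :=
    ringKrullDim_eq_three_of_intermediateField k' A ⟨s, hs⟩ hdimAeq A₂ hA₂fg hfr₂
  have hAA₂ : A.toSubring ≤ A₂.toSubring := hAA₁.trans hA₁A₂'
  have hzd₂ : ∀ (T : Subring K) (hT : T ≤ O.toSubring), A₂.toSubring ≤ T → (subringCentre T O hT).IsMaximal :=
    fun T hT hle => hzd T hT (hAA₂.trans hle)
  have hmax₂ : (subringCentre A₂.toSubring O hA₂O).IsMaximal := hzd₂ _ hA₂O le_rfl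
  have hreg₂ : IsRegularLocalRing (locAtCentre A₂.toSubring O) := (isRegularLocalRing_locAtCentre_iff hA₂O).mpr hreg₂'
  have hdim3₂ : ringKrullDim (locAtCentre A₂.toSubring O) = 3 := by
    rw [ringKrullDim_locAtCentre_eq_of_isMaximal A₂ hA₂fg O hA₂O hmax₂, hdimA₂]
  have htd₂ : ∀ hk' : ∀ c : k', algebraMap k' K c ∈ O, transcendenceDefect k' O hk' ≠ 0 := fun hk'' => by
    rw [transcendenceDefect_eq_of_intermediateField k' O hk hk'']
    exact htd hk
  -- T″ over the ground field `k'`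
  obtain ⟨A', hA'O, hA₂A', hA'fg, hreg', c, hc, hclean⟩ :=
    hT k' K O A₂ hA₂O hA₂fg hfr₂ hdimA₂.le hreg₂ hdim3₂ hzd₂ g₀ hg₀ hdefect htd₂ hnd hP2 hsep' hcomp' hks'
  -- back to `k`
  refine ⟨A'.restrictScalars k, hA'O, ?_, fg_restrictScalars_of_finiteDimensional k' A' hA'fg, hreg', c, hc, hclean⟩
  intro x hx
  exact hA₂A' (hAA₂ hx)

/-- The same with F-02 consumed in its main-theorem form `CossartPiltant2019` (✓ `CossartPiltant2019.lu3`); T″'s slice stays a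
hypothesis (`hT`, discharged BY NAME by `…CpSibling.TPrimeInf.cleanLU3DefectPRankTwoSepRes_of_cossartPiltant2019 p hCP hEmb` of the crux
workfile `Lens5_TPrimeInf.lean`, which is not an importable module). [folklore] -/
theorem cleanLU3DefectPRankTwoSepConst_of_cossartPiltant2019 (p : ℕ) (hCP : CossartPiltant2019.{0})
    (hT : CleanLU3DefectPRankTwoSepResAt p) : CleanLU3DefectPRankTwoSepConstAt p :=
  cleanLU3DefectPRankTwoSepConst_of_sepRes p (fun k _ => hCP.lu3 k) hT

/-! ## §4 Uptake glue for the lead's composition (pattern of §J of `Lens5_TPrimeInfCurrency.lean`)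

Template (a sketch for `cleanLU3DefectNonDiscrete_of_stubs`, NOT a prescription): give the research stub :279 a further negated hypothesis
`¬ (PRankTwoAt p O ∧ ∃ k′ : IntermediateField k K, FiniteDimensional k k′ ∧ SepGenerated k′ K ∧
   ∃ _ : Algebra k′ (IsLocalRing.ResidueField O), (compatibility) ∧ Algebra.IsSeparable k′ (IsLocalRing.ResidueField O))`
and discharge the new `by_cases` branch with
`cleanLUConcl_of_sepConst p (cleanLU3DefectPRankTwoSepConst_of_cossartPiltant2019 p stub_cossartPiltant2019 hT″) k K O A … hnd h6`,
`hT″ := TPrimeInf.cleanLU3DefectPRankTwoSepRes_of_cossartPiltant2019 p stub_cossartPiltant2019 stub_cjs2020Cor15` (ported names to be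
substituted by the registrar). -/

/-- **Uptake glue**: the T‴ slice, with its side conditions bundled into ONE hypothesis `h6` (the shape of a negated `by_cases` branch),
yields the conclusion of :279. [folklore] -/
theorem cleanLUConcl_of_sepConst (p : ℕ) (hC : CleanLU3DefectPRankTwoSepConstAt p)
    (k : Type) [Field k] [CharP k p] (K : Type) [Field K] [Algebra k K]
    (O : ValuationSubring K) (A : Subalgebra k K) (hAO : A.toSubring ≤ O.toSubring) (hAfg : A.FG) (hFrac : IsFractionRing A K)
    (hdimA : ringKrullDim A ≤ 3) (hreg : IsRegularLocalRing (locAtCentre A.toSubring O))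
    (hdim3 : ringKrullDim (locAtCentre A.toSubring O) = 3)
    (hzd : ∀ (T : Subring K) (hT : T ≤ O.toSubring), A.toSubring ≤ T → (subringCentre T O hT).IsMaximal)
    (g₀ : K) (hg₀ : ∀ c : K, c ^ p ≠ g₀)
    (hdefect : ∀ f₀ : K, ∃ f₁ : K, O.valuation (g₀ - f₁ ^ p) < O.valuation (g₀ - f₀ ^ p))
    (htd : ∀ hk : ∀ c : k, algebraMap k K c ∈ O, transcendenceDefect k O hk ≠ 0)
    (hnd : ¬ (∃ π : K, π ≠ 0 ∧ (∀ x : K, O.valuation x < 1 → O.valuation x ≤ O.valuation π) ∧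
      (∀ x : K, x ≠ 0 → ∃ n : ℕ, O.valuation π ^ n ≤ O.valuation x)))
    (h6 : PRankTwoAt p O ∧ ∃ k' : IntermediateField k K, FiniteDimensional k k' ∧ SepGenerated k' K ∧
      ∃ _ : Algebra k' (IsLocalRing.ResidueField O),
        (∀ (c : k') (h : algebraMap k' K c ∈ O),
          algebraMap k' (IsLocalRing.ResidueField O) c = IsLocalRing.residue O ⟨algebraMap k' K c, h⟩) ∧
        Algebra.IsSeparable k' (IsLocalRing.ResidueField O)) :
    CleanLUConcl p k K O A g₀ := by
  obtain ⟨hP2, k', hfin, hsep, _, hcomp, hks⟩ := h6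
  exact hC k K O A hAO hAfg hFrac hdimA hreg hdim3 hzd g₀ hg₀ hdefect htd hnd hP2 k' hfin hsep hcomp hks

end Summit.ResolutionOfSingularities.ResolutionOfSingularities.Theorems.RadicialJungCleanModels.Lens5TFrame

end
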